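import Mathlib.MeasureTheory.Integral.Bochner.Basic
import Mathlib.MeasureTheory.Measure.Lebesgue.EqHaar
import Literature.Analysis.FluidPDE.HarmonicProbe
import Literature.Analysis.FluidPDE.LerayProfileCalculus
import HarnessLib

/-!
# Tools for the Caccioppoli-type inequality of Seregin–Wang: the energy cut-off and Hölder on bounded sets

Analysis/FluidPDE support file (everything PROVED; no definitions, no named facts) on the
discharge path of the named fact `Literature.Analysis.FluidPDE.sereginWang_liouville_L3_annulus`
(Seregin–Wang 2020, Thm 1.1 (i), `q = ℓ = 3`, via the Caccioppoli-type inequality of their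
Prop. 2.1).  Two elementary toolkits used by the assembly (`SteadyNSLiouvilleProofs`):

* **the energy cut-off** `φ_R(x) = Φ(R⁻¹ x)`, `Φ = θ_{7/8,1/8}` (`θ = taoCutoff`, tree): smooth,
  values in `[0, 1]`, `= 1` on `B̄(0, 3R/4)`, `= 0` off `B(0, 7R/8)`, `‖Dφ_R‖ ≤ C₁/R`,
  `|Δφ_R| ≤ C₂/R²`, and `Dφ_R`, `Δφ_R` vanish off the closed shell `S₀ = {3R/4 ≤ |x| ≤ 7R/8}`
  (`exists_energyCutoff`: one existence statement carrying all the properties, so that the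
  assembly quantifies over an arbitrary such cut-off);
* **Hölder's inequality on bounded sets for continuous integrands** (exponents `3`, `3/2`),
  in Bochner-integral form: `∫_S |u| ≤ ‖u‖_{L³(S)} |S|^{2/3}`, `∫_S |u|² ≤ ‖u‖²_{L³(S)} |S|^{1/3}`,
  `∫_S |q| |u| ≤ ‖q‖_{L^{3/2}(S)} ‖u‖_{L³(S)}` with `‖u‖_{L³(S)} = (∫_S |u|³)^{1/3}`, the
  monotonicity of `S ↦ ∫_S |u|³`, and the identification
  `eLpNorm u 3 (volume.restrict S) = ofReal ((∫_S |u|³)^{1/3})` (Mathlib's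
  `integral_mul_le_Lp_mul_Lq_of_nonneg`, `MemLp.eLpNorm_eq_integral_rpow_norm`).

## References

* G. Seregin, W. Wang, St. Petersburg Math. J. 31 (2020) = arXiv:1805.02227, Prop. 2.1 and §3
  (Hölder's inequality on the annulus). [`SereginWang2020`]
-/

noncomputable section

open MeasureTheory Set Filter Topology InnerProductSpace Function Metric Bornology
open scoped RealInnerProductSpace Laplacian ENNReal NNReal ContDiff

namespace Literature.Analysis.FluidPDE

/-! ### The energy cut-off -/

section Cutoff

variable {E : Type*} [NormedAddCommGroup E] [InnerProductSpace ℝ E] [FiniteDimensional ℝ E]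

/-- `Δ(f(b ·))(z) = b² (Δf)(b z)` (the tree's `laplacian_const_smul_comp_smul` with `a = 1`).
[folklore] -/
theorem laplacian_comp_smul_apply {F : Type*} [NormedAddCommGroup F] [NormedSpace ℝ F]
    (f : E → F) {b : ℝ} (hb : b ≠ 0) (z : E) :
    (Δ (fun w => f (b • w))) z = (b ^ 2) • (Δ f) (b • z) := by
  have h := laplacian_const_smul_comp_smul f 1 hb z
  have e : (fun w => (1 : ℝ) • f (b • w)) = fun w => f (b • w) := by
    funext w; rw [one_smul]
  rw [e, one_mul] at h
  exact h

/-- The Laplacian of a constant function vanishes. [folklore] -/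
theorem laplacian_const_fun_eq_zero {F : Type*} [NormedAddCommGroup F] [NormedSpace ℝ F] (c : F)
    (x : E) : (Δ (fun _ : E => c)) x = 0 := by
  rw [laplacian_eq_iteratedFDeriv_stdOrthonormalBasis]
  simp [iteratedFDeriv_const_of_ne (𝕜 := ℝ) (n := 2) two_ne_zero c]

variable [MeasurableSpace E] [BorelSpace E]

omit [MeasurableSpace E] [BorelSpace E] in
/-- **The energy cut-off at scale `R > 0`.**  There is `φ ∈ C_c^∞(E)` with `0 ≤ φ ≤ 1`, `φ = 1` on
`B̄(0, 3R/4)`, `tsupport φ ⊆ B̄(0, 7R/8)`, `‖Dφ‖ ≤ C₁ R⁻¹`, `|Δφ| ≤ C₂ R⁻²`, and `Dφ(x) = 0`,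
`Δφ(x) = 0` unless `3R/4 ≤ |x| ≤ 7R/8`; the constants `C₁, C₂ ≥ 0` do not depend on `R`
(`φ(x) = θ_{7/8,1/8}(R⁻¹x)` with the tree's `taoCutoff`; `C₁ = sup ‖Dθ‖`, `C₂ = sup |Δθ|`).
[folklore] -/
theorem exists_energyCutoff :
    ∃ C₁ C₂ : ℝ, 0 ≤ C₁ ∧ 0 ≤ C₂ ∧ ∀ R : ℝ, 0 < R → ∃ φ : E → ℝ,
      ContDiff ℝ ∞ φ ∧ HasCompactSupport φ ∧ (∀ x, 0 ≤ φ x ∧ φ x ≤ 1) ∧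
      (∀ x, ‖x‖ ≤ 3 * R / 4 → φ x = 1) ∧ (∀ x, 7 * R / 8 ≤ ‖x‖ → φ x = 0) ∧
      (∀ x, ‖fderiv ℝ φ x‖ ≤ C₁ * R⁻¹) ∧ (∀ x, |(Δ φ) x| ≤ C₂ * R⁻¹ ^ 2) ∧
      (∀ x, ‖x‖ < 3 * R / 4 ∨ 7 * R / 8 < ‖x‖ → fderiv ℝ φ x = 0 ∧ (Δ φ) x = 0) := by
  set Φ : E → ℝ := taoCutoff (7 / 8) (1 / 8) with hΦ
  have hΦs : ContDiff ℝ ∞ Φ := contDiff_taoCutoff _ _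
  have hΦc : HasCompactSupport Φ := hasCompactSupport_taoCutoff (by norm_num) (by norm_num)
  have hΦ1 : ∀ y : E, ‖y‖ ≤ 3 / 4 → Φ y = 1 := fun y hy =>
    taoCutoff_eq_one_of_norm_le (by norm_num) (by norm_num) (by norm_num) (by norm_num; exact hy)
  have hΦ0 : ∀ y : E, 7 / 8 ≤ ‖y‖ → Φ y = 0 := fun y hy =>
    taoCutoff_eq_zero (by norm_num) (by norm_num) hy
  -- bounds for `DΦ`, `ΔΦ`
  obtain ⟨C₁, hC₁⟩ : ∃ C, ∀ y : E, ‖fderiv ℝ Φ y‖ ≤ C :=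
    ((contDiff_infty.1 hΦs 1).continuous_fderiv one_ne_zero).bounded_above_of_compact_support
      (hΦc.fderiv (𝕜 := ℝ))
  obtain ⟨C₂, hC₂⟩ : ∃ C, ∀ y : E, |(Δ Φ) y| ≤ C := by
    have hc : HasCompactSupport (Δ Φ) := hΦc.mono' fun y hy => by
      contrapose! hy
      simp [FluidPDE.laplacian_eq_zero_of_notMem_tsupport hy]
    obtain ⟨C, hC⟩ := (FluidPDE.continuous_laplacian (contDiff_infty.1 hΦs 2))
      |>.bounded_above_of_compact_support hc
    exact ⟨C, fun y => by rw [← Real.norm_eq_abs]; exact hC y⟩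
  have hC₁0 : 0 ≤ C₁ := le_trans (norm_nonneg _) (hC₁ 0)
  have hC₂0 : 0 ≤ C₂ := le_trans (abs_nonneg _) (hC₂ 0)
  refine ⟨C₁, C₂, hC₁0, hC₂0, fun R hR => ?_⟩
  set φ : E → ℝ := fun x => Φ (R⁻¹ • x) with hφ
  have hRi : R⁻¹ ≠ 0 := inv_ne_zero hR.ne'
  have hnorm : ∀ x : E, ‖R⁻¹ • x‖ = ‖x‖ / R := fun x => by
    rw [norm_smul, norm_inv, Real.norm_eq_abs, abs_of_pos hR, div_eq_inv_mul]
  have hφs : ContDiff ℝ ∞ φ := hΦs.comp (contDiff_const_smul _)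
  have hφ1 : ∀ x : E, ‖x‖ ≤ 3 * R / 4 → φ x = 1 := fun x hx => hΦ1 _ (by
    rw [hnorm, div_le_iff₀ hR]; linarith)
  have hφ0 : ∀ x : E, 7 * R / 8 ≤ ‖x‖ → φ x = 0 := fun x hx => hΦ0 _ (by
    rw [hnorm, le_div_iff₀ hR]; linarith)
  have hsupp : support φ ⊆ ball (0 : E) (7 * R / 8) := fun x hx => by
    rw [mem_ball_zero_iff]
    by_contra h
    exact hx (hφ0 x (not_lt.1 h))
  have htsupp : tsupport φ ⊆ closedBall (0 : E) (7 * R / 8) :=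
    (closure_mono hsupp).trans closure_ball_subset_closedBall
  have hφc : HasCompactSupport φ :=
    HasCompactSupport.of_support_subset_isCompact (isCompact_closedBall 0 _)
      (hsupp.trans ball_subset_closedBall)
  have hD : ∀ x, fderiv ℝ φ x = R⁻¹ • fderiv ℝ Φ (R⁻¹ • x) := fun x => by
    rw [hφ, _root_.fderiv_comp_smul]
  have hΔ : ∀ x, (Δ φ) x = (R⁻¹ ^ 2) • (Δ Φ) (R⁻¹ • x) := fun x =>
    laplacian_comp_smul_apply Φ hRi x
  refine ⟨φ, hφs, hφc, fun x => ⟨taoCutoff_nonneg _ _ _, taoCutoff_le_one _ _ _⟩, hφ1, hφ0,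
    fun x => ?_, fun x => ?_, fun x hx => ?_⟩
  · rw [hD x, norm_smul, norm_inv, Real.norm_eq_abs, abs_of_pos hR, mul_comm]
    exact mul_le_mul_of_nonneg_right (hC₁ _) (inv_nonneg.2 hR.le)
  · rw [hΔ x, smul_eq_mul, abs_mul, abs_of_nonneg (by positivity), mul_comm]
    exact mul_le_mul_of_nonneg_right (hC₂ _) (by positivity)
  · rcases hx with hx | hx
    · -- inside `B(0, 3R/4)` the cut-off is locally `1`
      have hev : φ =ᶠ[𝓝 x] fun _ => (1 : ℝ) := by
        filter_upwards [isOpen_ball.mem_nhds (mem_ball_zero_iff.2 hx)] with y hy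
        exact hφ1 y (le_of_lt (mem_ball_zero_iff.1 hy))
      refine ⟨?_, ?_⟩
      · rw [hev.fderiv_eq]; simp
      · rw [(laplacian_congr_nhds hev).eq_of_nhds, laplacian_const_fun_eq_zero]
    · -- outside `B̄(0, 7R/8)` the point is off the topological support
      have hxs : x ∉ tsupport φ := fun h => by
        have := htsupp h
        rw [mem_closedBall_zero_iff] at this
        linarith
      exact ⟨fderiv_of_notMem_tsupport ℝ hxs, FluidPDE.laplacian_eq_zero_of_notMem_tsupport hxs⟩

end Cutoff

/-! ### Hölder's inequality on bounded sets for continuous integrands -/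

section Holder

variable {E : Type*} [NormedAddCommGroup E] [InnerProductSpace ℝ E] [FiniteDimensional ℝ E]
  [MeasurableSpace E] [BorelSpace E]
variable {F : Type*} [NormedAddCommGroup F]

/-- A bounded set has finite Lebesgue measure.  DUPLICATE (dedup-00646) of Mathlib's
`Bornology.IsBounded.measure_lt_top` (bounded sets have finite measure for a locally finite
measure on a proper space); kept only as a deprecated name — write `hS.measure_lt_top`. [folklore] -/
@[deprecated Bornology.IsBounded.measure_lt_top (since := "2026-08-15")]
theorem measure_lt_top_of_isBounded' {S : Set E} (hS : IsBounded S) : volume S < ⊤ :=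
  hS.measure_lt_top

/-- A continuous function is in every `L^p` of the restriction of Lebesgue measure to a bounded
set. [folklore] -/
theorem memLp_restrict_of_continuous_isBounded {f : E → F} (hf : Continuous f) {S : Set E}
    (hS : IsBounded S) (p : ℝ≥0∞) : MemLp f p (volume.restrict S) := by
  obtain ⟨r, hr⟩ := hS.subset_closedBall 0
  haveI : IsFiniteMeasure (volume.restrict S) :=
    isFiniteMeasure_restrict.2 hS.measure_lt_top.ne
  obtain ⟨C, hC⟩ := (isCompact_closedBall (0 : E) r).exists_bound_of_continuousOn hf.continuousOn
  refine MemLp.of_bound hf.aestronglyMeasurable C ?_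
  refine ae_restrict_of_ae_restrict_of_subset hr ?_
  exact ae_restrict_of_forall_mem measurableSet_closedBall hC

/-- `∫_S |u|³ ≥ 0`. [folklore] -/
theorem setIntegral_norm_rpow_three_nonneg (u : E → F) (S : Set E) :
    0 ≤ ∫ x in S, ‖u x‖ ^ (3 : ℝ) :=
  integral_nonneg fun _ => Real.rpow_nonneg (norm_nonneg _) _

/-- **Hölder, exponents `(3, 3/2)` against `1`**: `∫_S |u| ≤ (∫_S |u|³)^{1/3} |S|^{2/3}` for a
continuous `u` and a bounded measurable `S`. [folklore] -/
theorem setIntegral_norm_le_rpow_three {u : E → F} (hu : Continuous u) {S : Set E}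
    (hS : IsBounded S) :
    ∫ x in S, ‖u x‖ ≤ (∫ x in S, ‖u x‖ ^ (3 : ℝ)) ^ (1 / 3 : ℝ) *
      (volume.real S) ^ (1 / (3 / 2) : ℝ) := by
  haveI : IsFiniteMeasure (volume.restrict S) :=
    isFiniteMeasure_restrict.2 hS.measure_lt_top.ne
  have hpq : Real.HolderConjugate 3 (3 / 2) := ⟨by norm_num, by norm_num, by norm_num⟩
  have h := integral_mul_le_Lp_mul_Lq_of_nonneg (μ := volume.restrict S) hpq
    (f := fun x => ‖u x‖) (g := fun _ => (1 : ℝ))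
    (Eventually.of_forall fun x => norm_nonneg _) (Eventually.of_forall fun _ => zero_le_one)
    ((memLp_restrict_of_continuous_isBounded hu hS _).norm)
    (memLp_const 1)
  simp only [mul_one, Real.one_rpow, integral_const, smul_eq_mul, measureReal_def,
    Measure.restrict_apply_univ] at h
  simpa [measureReal_def] using h

/-- **Hölder, exponents `(3/2, 3)` against `1`**: `∫_S |u|² ≤ (∫_S |u|³)^{2/3} |S|^{1/3}`.
[folklore] -/
theorem setIntegral_norm_sq_le_rpow_three {u : E → F} (hu : Continuous u) {S : Set E}
    (hS : IsBounded S) :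
    ∫ x in S, ‖u x‖ ^ 2 ≤ (∫ x in S, ‖u x‖ ^ (3 : ℝ)) ^ (1 / (3 / 2) : ℝ) *
      (volume.real S) ^ (1 / 3 : ℝ) := by
  haveI : IsFiniteMeasure (volume.restrict S) :=
    isFiniteMeasure_restrict.2 hS.measure_lt_top.ne
  have hpq : Real.HolderConjugate (3 / 2) 3 := ⟨by norm_num, by norm_num, by norm_num⟩
  have h := integral_mul_le_Lp_mul_Lq_of_nonneg (μ := volume.restrict S) hpq
    (f := fun x => ‖u x‖ ^ 2) (g := fun _ => (1 : ℝ))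
    (Eventually.of_forall fun x => sq_nonneg _) (Eventually.of_forall fun _ => zero_le_one)
    (memLp_restrict_of_continuous_isBounded (f := fun x => ‖u x‖ ^ 2) (hu.norm.pow 2) hS _)
    (memLp_const 1)
  have e : ∀ x : E, (‖u x‖ ^ 2) ^ (3 / 2 : ℝ) = ‖u x‖ ^ (3 : ℝ) := fun x => by
    rw [← Real.rpow_natCast, ← Real.rpow_mul (norm_nonneg _)]
    norm_num
  simp only [mul_one, Real.one_rpow, integral_const, smul_eq_mul, measureReal_def,
    Measure.restrict_apply_univ, e] at h
  simpa [measureReal_def] using h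

/-- **Hölder, exponents `(3/2, 3)`**: `∫_S |q| |u| ≤ (∫_S |q|^{3/2})^{2/3} (∫_S |u|³)^{1/3}` for
continuous `q`, `u` and bounded `S`. [folklore] -/
theorem setIntegral_mul_norm_le_rpow {q : E → ℝ} (hq : Continuous q) {u : E → F}
    (hu : Continuous u) {S : Set E} (hS : IsBounded S) :
    ∫ x in S, |q x| * ‖u x‖ ≤ (∫ x in S, |q x| ^ (3 / 2 : ℝ)) ^ (1 / (3 / 2) : ℝ) *
      (∫ x in S, ‖u x‖ ^ (3 : ℝ)) ^ (1 / 3 : ℝ) := by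
  have hpq : Real.HolderConjugate (3 / 2) 3 := ⟨by norm_num, by norm_num, by norm_num⟩
  exact integral_mul_le_Lp_mul_Lq_of_nonneg (μ := volume.restrict S) hpq
    (f := fun x => |q x|) (g := fun x => ‖u x‖)
    (Eventually.of_forall fun x => abs_nonneg _) (Eventually.of_forall fun _ => norm_nonneg _)
    (by simpa using (memLp_restrict_of_continuous_isBounded hq hS _).norm)
    ((memLp_restrict_of_continuous_isBounded hu hS _).norm)

/-- Monotonicity of `S ↦ ∫_S |u|³` for continuous `u` and bounded `T ⊇ S`. [folklore] -/
theorem setIntegral_norm_rpow_mono {u : E → F} (hu : Continuous u) {S T : Set E} (hST : S ⊆ T)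
    (hT : IsBounded T) (r : ℝ) (hr : 0 ≤ r) :
    ∫ x in S, ‖u x‖ ^ r ≤ ∫ x in T, ‖u x‖ ^ r := by
  refine setIntegral_mono_set ?_ (Eventually.of_forall fun x => Real.rpow_nonneg (norm_nonneg _) _)
    (Eventually.of_forall hST)
  have : MemLp (fun x => ‖u x‖ ^ r) 1 (volume.restrict T) :=
    memLp_restrict_of_continuous_isBounded (hu.norm.rpow_const fun _ => Or.inr hr) hT 1
  exact memLp_one_iff_integrable.1 this

/-- Monotonicity of `S ↦ ∫_S |q|^{3/2}` towards the whole-space integral, for an integrable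
power. [folklore] -/
theorem setIntegral_abs_rpow_le_integral {q : E → ℝ} {r : ℝ}
    (hq : Integrable fun x => |q x| ^ r) (S : Set E) :
    ∫ x in S, |q x| ^ r ≤ ∫ x, |q x| ^ r :=
  setIntegral_le_integral hq (Eventually.of_forall fun _ => Real.rpow_nonneg (abs_nonneg _) _)

/-- **`L³` norm on a bounded set, real form**: `eLpNorm u 3 (volume.restrict S) =
ofReal ((∫_S |u|³)^{1/3})` for continuous `u`. [folklore] -/
theorem eLpNorm_three_restrict_eq_ofReal {u : E → F} (hu : Continuous u) {S : Set E}
    (hS : IsBounded S) :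
    eLpNorm u 3 (volume.restrict S) =
      ENNReal.ofReal ((∫ x in S, ‖u x‖ ^ (3 : ℝ)) ^ (1 / 3 : ℝ)) := by
  rw [(memLp_restrict_of_continuous_isBounded hu hS 3).eLpNorm_eq_integral_rpow_norm
    (by norm_num) (by norm_num)]
  norm_num

/-- **`L^{3/2}` norm, real form**: `eLpNorm q (3/2) volume = ofReal ((∫ |q|^{3/2})^{2/3})` for
`q ∈ L^{3/2}`. [folklore] -/
theorem eLpNorm_threeHalves_eq_ofReal {q : E → ℝ} (hq : MemLp q (3 / 2) volume) :
    eLpNorm q (3 / 2) volume =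
      ENNReal.ofReal ((∫ x, |q x| ^ (3 / 2 : ℝ)) ^ (1 / (3 / 2) : ℝ)) := by
  have h32 : (3 / 2 : ℝ≥0∞) ≠ 0 := by norm_num
  have h32' : (3 / 2 : ℝ≥0∞) ≠ ⊤ := ENNReal.div_ne_top (by norm_num) (by norm_num)
  rw [hq.eLpNorm_eq_integral_rpow_norm h32 h32']
  have e : (3 / 2 : ℝ≥0∞).toReal = 3 / 2 := by
    rw [ENNReal.toReal_div]; norm_num
  simp only [e, Real.norm_eq_abs, one_div]

/-- The integrand `|q|^{3/2}` of an `L^{3/2}` function is integrable. [folklore] -/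
theorem integrable_abs_rpow_threeHalves {q : E → ℝ} (hq : MemLp q (3 / 2) volume) :
    Integrable fun x => |q x| ^ (3 / 2 : ℝ) := by
  have h := hq.integrable_norm_rpow (by norm_num) (ENNReal.div_ne_top (by norm_num) (by norm_num))
  have e : (3 / 2 : ℝ≥0∞).toReal = 3 / 2 := by
    rw [ENNReal.toReal_div]; norm_num
  simpa [e, Real.norm_eq_abs] using h

/-- Volume of closed balls in real form, dimension read off `finrank`:
`|B̄(x, r)| = r^d |B₁|`.  DUPLICATE (dedup-00647): the `μ := volume` instance of Mathlib's
`MeasureTheory.Measure.addHaar_real_closedBall`; kept only as a deprecated name — write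
`Measure.addHaar_real_closedBall volume x hr`. [folklore] -/
@[deprecated MeasureTheory.Measure.addHaar_real_closedBall (since := "2026-08-15")]
theorem volume_real_closedBall_eq (x : E) {r : ℝ} (hr : 0 ≤ r) :
    volume.real (closedBall x r) = r ^ Module.finrank ℝ E * volume.real (ball (0 : E) 1) :=
  Measure.addHaar_real_closedBall volume x hr

/-- `volume.real S ≤ r^d |B₁|` for `S ⊆ B̄(0, r)`. [folklore] -/
theorem volume_real_le_of_subset_closedBall {S : Set E} {r : ℝ} (hr : 0 ≤ r)
    (hS : S ⊆ closedBall (0 : E) r) :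
    volume.real S ≤ r ^ Module.finrank ℝ E * volume.real (ball (0 : E) 1) := by
  rw [← Measure.addHaar_real_closedBall volume 0 hr]
  exact measureReal_mono hS measure_closedBall_lt_top.ne

end Holder

end Literature.Analysis.FluidPDE

end
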